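import Summits.CriticalPhenomena.SAWScalingLimit.Theorems.BoundaryClosureR.Negative.ShiftedHalfDisc
import Summits.CriticalPhenomena.SAWScalingLimit.Theorems.BoundaryClosureR.Negative.EndCorridor
import Summits.CriticalPhenomena.SAWScalingLimit.Theorems.BoundaryClosureR.Negative.RootPin

/-!
# Negative knowledge on crux `BoundaryClosureR` (stmt-CriticalPhenomena-14004), part 4/5: the lattice pin
at the NORMALISATION point of `HexObservableLimitR` is load-bearing

`not_hexObservableLimit_without_normaliserPin`: the repaired target with the lattice pin at `b = pt 1`
removed (flatness of `∂Ω` at both marked points and the lattice pin at the root KEPT) is FALSE.  Witness: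
the dead-end corridor ENDING at `b_δ` — on the upper half unit disc rooted at the pinned vertical edge
`bEdge → 0 = pt 0`, the body normalised at its junction edge `aEdge X → 1/2` versus body ∪ corridor
normalised at the tip `aEdge T → 3/4`; both satisfy every hypothesis (`instance_limit_end`, uniformiser
`Ψ_r`, logarithm `M_r` from part 1; reversed straight walk `nonempty_rowSAW_rev`), the bulk values agree
and the normalisations differ by `κ`, `‖κ‖ = x_c^{2T-2X} → 0` (part 3), so `N_body → 0` as well as
`→ c ∫ψ e^{(5/8)(M - M_b)}`; `c ≠ 0` and the test-function lemma kill the exponential density.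
Reading for provers: any proof of `HexObservableLimitR` (hence of `BoundaryClosureR`) must use the EXACT
half-lattice at `b` — `∂Ω` smooth near `b` plus `b_δ → b`, all that Duminil-Copin–Smirnov's Conjecture 2
asks verbatim, does not pin the normalisation.  Everything proved. [folklore]
-/

noncomputable section

open Set Filter Topology Complex
open Literature.Probability.RandomPlanarGeometry
open UpperHalfPlane (upperHalfPlaneSet)
open Literature.Probability.LatticeModels Literature.Probability.RandomPlanarGeometry.SAW

namespace Summit.CriticalPhenomena.SAWScalingLimit.Theorems.BoundaryClosureR.Negative

open BoundaryClosure.Negative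

/-! ## Part D — one instance of the hypotheses (root pinned, normaliser free) and the refutation -/

/-- **The straight walk, reversed**: a self-avoiding walk from `bEdge` to the edge `aEdge N` along
row `0`, in any vertex set containing the faces `fj i 0`, `i ≤ 2N+1`. [folklore] -/
theorem nonempty_rowSAW_rev (Λ : Finset HexVertex) (N : ℕ) (hΛ : ∀ i : ℕ, i ≤ 2 * N + 1 → fj i 0 ∈ Λ) :
    Nonempty (HexMidEdgeSAW Λ bEdge (aEdge N)) := by
  set L := (rowWalk (2 * N + 1)).reverse with hL
  have hmemL : ∀ v ∈ L, ∃ i : ℕ, i ≤ 2 * N + 1 ∧ v = fj i 0 := fun v hv =>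
    mem_rowWalk.1 (List.mem_reverse.1 hv)
  have hmem : ∀ e ∈ List.zipWith (fun u w => s(u, w)) L L.tail,
      ∀ c ∈ e, ∃ i : ℕ, i ≤ 2 * N + 1 ∧ c = fj i 0 := fun e he c hc =>
    hmemL c (forall_mem_of_mem_edges _ e he c hc)
  have haL : aEdge (N : ℤ) ∉ List.zipWith (fun u w => s(u, w)) L L.tail := by
    intro h
    obtain ⟨i, hi, he⟩ := hmem _ h (fj (2 * N + 2) 0) (by unfold aEdge; exact Sym2.mem_mk_left _ _)
    have := (fj_inj.1 he).1; omega
  have hab : aEdge (N : ℤ) ≠ bEdge := by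
    intro h
    have : fj (2 * (N : ℤ) + 2) 0 ∈ bEdge := by rw [← h]; unfold aEdge; exact Sym2.mem_mk_left _ _
    unfold bEdge at this
    rcases Sym2.mem_iff.1 this with h1 | h1
    · have := (fj_inj.1 h1).1; omega
    · have := (fj_inj.1 h1).2; omega
  have hbL : bEdge ∉ List.zipWith (fun u w => s(u, w)) L L.tail := by
    intro he
    obtain ⟨i, hi, he'⟩ := hmem _ he (fj 1 (-1)) (by exact Sym2.mem_mk_right _ _)
    have := (fj_inj.1 he').2; omega
  have hadj : hexGraph.Adj (fj 0 0) (fj 1 (-1)) := by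
    simpa using adj_fj_down (show (0:ℤ) % 2 = 0 by norm_num) 0
  have hLne : L ≠ [] := by rw [hL]; simpa using rowWalk_ne_nil _
  refine ⟨{ verts := L
            subset := fun v hv => ?_
            nodup := List.nodup_reverse.2 (nodup_rowWalk _)
            isChain := List.isChain_reverse.2 ((isChain_rowWalk _).imp fun a b h => h.symm)
            head_mem := fun v hv => ?_
            getLast_mem := fun v hv => ?_
            eq_of_nil := fun h => (hLne h).elim
            edges_nodup := fun _ => ?_
            fst_mem := ⟨(SimpleGraph.mem_edgeSet hexGraph).2 hadj, fj 0 0, Sym2.mem_mk_left _ _,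
              by exact_mod_cast hΛ 0 (by omega)⟩ }⟩
  · obtain ⟨i, hi, rfl⟩ := hmemL v hv
    exact hΛ i hi
  · rw [hL, List.head?_reverse, getLast?_rowWalk, Option.some_inj] at hv
    subst hv
    exact Sym2.mem_mk_left _ _
  · rw [hL, List.getLast?_reverse, head?_rowWalk, Option.some_inj] at hv
    subst hv
    unfold aEdge
    exact Sym2.mem_mk_right _ _
  · have hLn := edges_nodup (List.nodup_reverse.2 (nodup_rowWalk (2 * N + 1)))
    rw [← hL] at hLn
    refine List.nodup_append.2 ⟨List.nodup_cons.2 ⟨hbL, hLn⟩, List.nodup_singleton _, ?_⟩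
    intro e he f hf
    rw [List.mem_singleton] at hf
    subst hf
    rcases List.mem_cons.1 he with rfl | he
    · exact hab.symm
    · rintro rfl; exact haL he

section Geometry

variable {δ : ℝ} (hδ : 0 < δ) (hδ' : δ ≤ 1 / 16) (wc : Bool)
include hδ hδ'

/-- **There is a self-avoiding walk from the pinned root `bEdge` to the normalisation edge.** [folklore] -/
theorem nonempty_saw_rev : Nonempty (HexMidEdgeSAW (Lam δ wc) bEdge (aEdge (rootCell δ wc))) := by
  have hb := rootCell_bounds hδ hδ' wc
  have hX := Xc_pos hδ (δ := δ)
  obtain ⟨N, hN⟩ : ∃ N : ℕ, (N : ℤ) = rootCell δ wc := ⟨(rootCell δ wc).toNat, by omega⟩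
  rw [← hN]
  exact nonempty_rowSAW_rev (Lam δ wc) N fun i hi => fj_row_zero_mem hδ hδ' wc (by omega) (by omega)

end Geometry

/-- **One instance of the normaliser-unpinned statement on the half-disc**: configuration `wc` rooted at
the PINNED edge `bEdge` (marked point `pt 0 = 0`, exact half-lattice in `ball 0 (1/4)`) and normalised at
the FREE boundary mid-edge `aEdge (rootCell δ wc)` (marked point `pt 1 = r`, `r = 1/2` for the body's
junction edge, `r = 3/4` for the corridor tip; the boundary of the half-disc is flat there) satisfies
every hypothesis, so the normalised averages converge to the predicted limit
`c ∫ ψ e^{(5/8)(M_r - M_r r)}`. [folklore] -/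
theorem instance_limit_end {c : ℂ}
    (H : ∀ (D : Literature.Probability.RandomPlanarGeometry.DobrushinDomain) (ρ : ℝ)
      (Λ : ℝ → Finset Literature.Probability.LatticeModels.HexVertex) (m : ℝ → ℤ)
      (a b : ℝ → Sym2 Literature.Probability.LatticeModels.HexVertex)
      (Φ : Literature.Probability.RandomPlanarGeometry.ConformalEquiv D.carrier UpperHalfPlane.upperHalfPlaneSet)
      (L : ℂ → ℂ) (Lb : ℂ) (ψ : ℂ → ℂ),
      let F : ℝ → Sym2 Literature.Probability.LatticeModels.HexVertex → ℂ := fun δ z =>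
        Literature.Probability.RandomPlanarGeometry.SAW.hexParafermionicObservable (Λ δ) (a δ)
          Literature.Probability.RandomPlanarGeometry.SAW.hexCriticalFugacity (5 / 8) z
      0 < ρ → (∀ i : Fin 2, D.carrier ∩ Metric.ball (D.pt i) ρ = {z : ℂ | (D.pt i).im < z.im} ∩ Metric.ball (D.pt i) ρ) →
      (∀ᶠ δ : ℝ in nhdsWithin 0 (Set.Ioi 0),
        Literature.Probability.RandomPlanarGeometry.SAW.hexDomainSimplyConnected (Λ δ) ∧
        a δ ∈ Literature.Probability.RandomPlanarGeometry.SAW.hexDomainBoundary (Λ δ) ∧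
        b δ ∈ Literature.Probability.RandomPlanarGeometry.SAW.hexDomainBoundary (Λ δ) ∧
        Nonempty (Literature.Probability.RandomPlanarGeometry.SAW.HexMidEdgeSAW (Λ δ) (a δ) (b δ)) ∧
        (Literature.Probability.LatticeModels.hexGraph.induce ((Λ δ : Finset
          Literature.Probability.LatticeModels.HexVertex) : Set
          Literature.Probability.LatticeModels.HexVertex)).Preconnected ∧
        (∀ v ∈ Λ δ, (δ : ℂ) * Literature.Probability.LatticeModels.hexCenter v ∈ D.carrier) ∧
        (∀ v : Literature.Probability.LatticeModels.HexVertex, (δ : ℂ) *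
          Literature.Probability.LatticeModels.hexCenter v ∈ Metric.ball (D.pt 0) ρ → (v ∈ Λ δ ↔ m δ ≤ v.1 1))) →
      (∀ K : Set ℂ, IsCompact K → K ⊆ D.carrier → ∀ᶠ δ : ℝ in nhdsWithin 0 (Set.Ioi 0), ∀ v :
        Literature.Probability.LatticeModels.HexVertex, (δ : ℂ) *
        Literature.Probability.LatticeModels.hexCenter v ∈ K → v ∈ Λ δ) →
      Filter.Tendsto (fun δ : ℝ => (δ : ℂ) * Literature.Probability.RandomPlanarGeometry.SAW.hexMidpoint (a δ))
        (nhdsWithin 0 (Set.Ioi 0)) (nhds (D.pt 0)) →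
      Filter.Tendsto (fun δ : ℝ => (δ : ℂ) * Literature.Probability.RandomPlanarGeometry.SAW.hexMidpoint (b δ))
        (nhdsWithin 0 (Set.Ioi 0)) (nhds (D.pt 1)) →
      Filter.Tendsto (fun x => ‖Φ x‖) (nhdsWithin (D.pt 0) D.carrier) Filter.atTop →
      Φ.HasBoundaryValue (D.pt 1) 0 → ContinuousOn L D.carrier → (∀ z ∈ D.carrier, Complex.exp (L z) = deriv Φ z) →
      Filter.Tendsto L (nhdsWithin (D.pt 1) D.carrier) (nhds Lb) → Continuous ψ → HasCompactSupport ψ →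
      tsupport ψ ⊆ D.carrier →
      Filter.Tendsto (fun δ : ℝ => (δ : ℂ) ^ 2 * (∑ᶠ e ∈
        Literature.Probability.RandomPlanarGeometry.SAW.hexDomainMidEdges (Λ δ), ψ ((δ : ℂ) *
        Literature.Probability.RandomPlanarGeometry.SAW.hexMidpoint e) * F δ e) / F δ (b δ))
        (nhdsWithin 0 (Set.Ioi 0)) (nhds (c * ∫ z, ψ z * Complex.exp ((5 / 8 : ℂ) * (L z - Lb)))))
    {r : ℝ} (hr : 0 < r ∧ r < 1) (hr' : r ≤ 3 / 4) (wc : Bool)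
    (hroot : ∀ δ : ℝ, 0 < δ → |δ * rootCell δ wc - r| ≤ δ)
    {ψ : ℂ → ℂ} (hψc : Continuous ψ) (hψK : HasCompactSupport ψ) (hψD : tsupport ψ ⊆ HD) :
    Filter.Tendsto (NR wc ψ) (nhdsWithin 0 (Set.Ioi 0))
      (nhds (c * ∫ z, ψ z * Complex.exp ((5 / 8 : ℂ) * (Mfun r z - Mfun r r)))) := by
  have H' := H (halfDiscDomain' r hr) (1 / 4) (fun δ => Lam δ wc) (fun _ => 0) (fun _ => bEdge)
    (fun δ => aEdge (rootCell δ wc)) (PsiCE r hr) (Mfun r) (Mfun r r) ψ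
  simp only [pt_zero_halfDiscDomain', pt_one_halfDiscDomain', carrier_halfDiscDomain'] at H'
  refine H' (by norm_num) ?_ ?_ ?_ ?_ ?_ (tendsto_norm_PsiCE hr) (tendsto_PsiCE_r hr)
    (continuousOn_Mfun hr) (fun z hz => exp_Mfun hr hz) (tendsto_Mfun_r hr) hψc hψK hψD
  · -- flatness at both marked points
    refine Fin.forall_fin_two.2 ⟨?_, ?_⟩
    · rw [pt_zero_halfDiscDomain']
      simpa using HD_inter_ball_real (p := 0) (ρ := 1 / 4) (by norm_num)
    · rw [pt_one_halfDiscDomain']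
      simpa using HD_inter_ball_real (p := r) (ρ := 1 / 4) (by rw [abs_of_pos hr.1]; linarith)
  · -- the discrete hypotheses, for `0 < δ ≤ 1/16`
    filter_upwards [eventually_small one_pos] with δ hδ
    obtain ⟨hδ, hδ', -⟩ := hδ
    refine ⟨simplyConnected_Lam hδ hδ' wc, bEdge_mem_boundary hδ hδ' wc, aEdge_mem_boundary hδ hδ' wc,
      nonempty_saw_rev hδ hδ' wc, preconnected_Lam hδ hδ' wc, fun v hv => smul_center_mem_HD hδ hδ' wc hv,
      fun v hv => ?_⟩
    refine mem_Lam_iff_of_ball hδ hδ' wc ?_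
    rw [Metric.mem_ball] at hv ⊢
    linarith
  · -- exhaustion of compacts
    intro K hK hKD
    obtain ⟨ε, hε, hε1, hthick⟩ := exists_thick_of_isCompact hK hKD
    filter_upwards [eventually_small (by positivity : 0 < ε / 4)] with δ hδ v hv
    obtain ⟨hδ, hδ', hδε⟩ := hδ
    obtain ⟨hn, hi⟩ := hthick _ hv
    exact mem_Lam_of_thick hδ hδ' wc hδε hn hi
  · exact tendsto_smul_midpoint_bEdge
  · exact tendsto_smul_midpoint_aEdge hroot

/-- **Refutation of `HexObservableLimitR` with the normaliser's lattice pin removed** (root pinned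
conformally, boundary FLAT near `b`, discretisation exact only at the root): the dead-end corridor
ending at `b_δ` makes `F_δ(b_δ)` smaller by the factor `x_c^{2T-2X} → 0` while leaving the bulk values
and every hypothesis untouched, so the normalised averages of the body would have to converge both to
`c ∫ψ e^{(5/8)(M - M_b)}` and to `0`; `c ≠ 0` and the test-function lemma then force the density
`e^{(5/8)(M - M_b)}` to vanish on the half-disc: contradiction.  Hence the rigid half-lattice ball at
the NORMALISATION point is load-bearing in `HexObservableLimitR` (flatness of `∂Ω` near `b` and
`b_δ → b` do not suffice). [folklore] -/
theorem not_hexObservableLimit_without_normaliserPin : ¬ ∃ c : ℂ, c ≠ 0 ∧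
    ∀ (D : Literature.Probability.RandomPlanarGeometry.DobrushinDomain) (ρ : ℝ)
      (Λ : ℝ → Finset Literature.Probability.LatticeModels.HexVertex) (m : ℝ → ℤ)
      (a b : ℝ → Sym2 Literature.Probability.LatticeModels.HexVertex)
      (Φ : Literature.Probability.RandomPlanarGeometry.ConformalEquiv D.carrier UpperHalfPlane.upperHalfPlaneSet)
      (L : ℂ → ℂ) (Lb : ℂ) (ψ : ℂ → ℂ),
      let F : ℝ → Sym2 Literature.Probability.LatticeModels.HexVertex → ℂ := fun δ z =>
        Literature.Probability.RandomPlanarGeometry.SAW.hexParafermionicObservable (Λ δ) (a δ)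
          Literature.Probability.RandomPlanarGeometry.SAW.hexCriticalFugacity (5 / 8) z
      0 < ρ → (∀ i : Fin 2, D.carrier ∩ Metric.ball (D.pt i) ρ = {z : ℂ | (D.pt i).im < z.im} ∩ Metric.ball (D.pt i) ρ) →
      (∀ᶠ δ : ℝ in nhdsWithin 0 (Set.Ioi 0),
        Literature.Probability.RandomPlanarGeometry.SAW.hexDomainSimplyConnected (Λ δ) ∧
        a δ ∈ Literature.Probability.RandomPlanarGeometry.SAW.hexDomainBoundary (Λ δ) ∧
        b δ ∈ Literature.Probability.RandomPlanarGeometry.SAW.hexDomainBoundary (Λ δ) ∧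
        Nonempty (Literature.Probability.RandomPlanarGeometry.SAW.HexMidEdgeSAW (Λ δ) (a δ) (b δ)) ∧
        (Literature.Probability.LatticeModels.hexGraph.induce ((Λ δ : Finset
          Literature.Probability.LatticeModels.HexVertex) : Set
          Literature.Probability.LatticeModels.HexVertex)).Preconnected ∧
        (∀ v ∈ Λ δ, (δ : ℂ) * Literature.Probability.LatticeModels.hexCenter v ∈ D.carrier) ∧
        (∀ v : Literature.Probability.LatticeModels.HexVertex, (δ : ℂ) *
          Literature.Probability.LatticeModels.hexCenter v ∈ Metric.ball (D.pt 0) ρ → (v ∈ Λ δ ↔ m δ ≤ v.1 1))) →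
      (∀ K : Set ℂ, IsCompact K → K ⊆ D.carrier → ∀ᶠ δ : ℝ in nhdsWithin 0 (Set.Ioi 0), ∀ v :
        Literature.Probability.LatticeModels.HexVertex, (δ : ℂ) *
        Literature.Probability.LatticeModels.hexCenter v ∈ K → v ∈ Λ δ) →
      Filter.Tendsto (fun δ : ℝ => (δ : ℂ) * Literature.Probability.RandomPlanarGeometry.SAW.hexMidpoint (a δ))
        (nhdsWithin 0 (Set.Ioi 0)) (nhds (D.pt 0)) →
      Filter.Tendsto (fun δ : ℝ => (δ : ℂ) * Literature.Probability.RandomPlanarGeometry.SAW.hexMidpoint (b δ))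
        (nhdsWithin 0 (Set.Ioi 0)) (nhds (D.pt 1)) →
      Filter.Tendsto (fun x => ‖Φ x‖) (nhdsWithin (D.pt 0) D.carrier) Filter.atTop →
      Φ.HasBoundaryValue (D.pt 1) 0 → ContinuousOn L D.carrier → (∀ z ∈ D.carrier, Complex.exp (L z) = deriv Φ z) →
      Filter.Tendsto L (nhdsWithin (D.pt 1) D.carrier) (nhds Lb) → Continuous ψ → HasCompactSupport ψ →
      tsupport ψ ⊆ D.carrier →
      Filter.Tendsto (fun δ : ℝ => (δ : ℂ) ^ 2 * (∑ᶠ e ∈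
        Literature.Probability.RandomPlanarGeometry.SAW.hexDomainMidEdges (Λ δ), ψ ((δ : ℂ) *
        Literature.Probability.RandomPlanarGeometry.SAW.hexMidpoint e) * F δ e) / F δ (b δ))
        (nhdsWithin 0 (Set.Ioi 0)) (nhds (c * ∫ z, ψ z * Complex.exp ((5 / 8 : ℂ) * (L z - Lb)))) := by
  rintro ⟨c, hc, H⟩
  have hp : (0 : ℝ) < 3 / 4 ∧ (3 / 4 : ℝ) < 1 := by norm_num
  have hq : (0 : ℝ) < 1 / 2 ∧ (1 / 2 : ℝ) < 1 := by norm_num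
  have hx := hexCriticalFugacity_pos_lt_one
  -- Step 1: every test function is orthogonal to the predicted density of the body configuration
  have key : ∀ ψ : ℂ → ℂ, Continuous ψ → HasCompactSupport ψ → tsupport ψ ⊆ HD →
      ∫ z, ψ z * Complex.exp ((5 / 8 : ℂ) * (Mfun (1 / 2) z - Mfun (1 / 2) ((1 / 2 : ℝ) : ℂ))) = 0 := by
    intro ψ hψc hψK hψD
    have h1 := instance_limit_end H hq (by norm_num) false (fun δ hδ => abs_Xc δ hδ) hψc hψK hψD
    have h2 := instance_limit_end H hp le_rfl true (fun δ hδ => abs_Tc δ hδ) hψc hψK hψD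
    -- `‖N_body‖ = x_c^{2T-2X} ‖N_{body ∪ corridor}‖` for small `δ`
    obtain ⟨ε, hε, -, hthick⟩ := exists_thick_of_isCompact hψK hψD
    have hev : ∀ᶠ δ : ℝ in 𝓝[>] 0, ‖NR false ψ δ‖ ≤ hexCriticalFugacity ^ corrLen δ * ‖NR true ψ δ‖ := by
      filter_upwards [eventually_small (by positivity : 0 < ε / 2)] with δ hδ
      obtain ⟨hδ, hδ', hδε⟩ := hδ
      obtain ⟨κ, hκ, hrel⟩ := NR_false_eq hδ hδ' ψ fun e he => by
        have hmem : (δ : ℂ) * hexMidpoint e ∈ tsupport ψ := subset_tsupport _ he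
        have him := (hthick _ hmem).2
        rw [Complex.im_ofReal_mul] at him
        by_contra hlt
        push Not at hlt
        nlinarith
      rw [hrel, norm_mul, hκ]
    have h0 : Tendsto (NR false ψ) (𝓝[>] 0) (𝓝 0) :=
      squeeze_zero_norm' hev (by simpa using tendsto_pow_corrLen.mul h2.norm)
    have := tendsto_nhds_unique h1 h0
    exact (mul_eq_zero.1 this).resolve_left hc
  -- Step 2: the density vanishes at a point of the half-disc, but it is an exponential
  have h0 := eq_zero_of_forall_integral isOpen_HD (continuousOn_gM hq) key I_half_mem_HD
  exact Complex.exp_ne_zero _ h0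

end Summit.CriticalPhenomena.SAWScalingLimit.Theorems.BoundaryClosureR.Negative
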